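import Literature.Geometry.Lorentzian.CoordMomentumConstraintAdjoint
import HarnessLib

/-!
# The formal adjoint of the linearised constraint map and the KID identity

Everything here is PROVED; the file introduces the explicit definitions `linHamFn`, `adjHamG`,
`adjHamK` and no statement of `Prop` type.

Completing `CoordScalarCurvatureAdjoint.lean` (the `DS_G`, `DS*_G` Green identity) and
`CoordMomentumConstraintAdjoint.lean` (the `DM`, `DM*` Green identity): for data `(G, K)` in
the coordinate tensor calculus (`MetricCoord.IsMetricOn G V`, any signature), smooth symmetric
variations `(γ, κ)` and a lapse–shift multiplier `(N, X)`,

* `linHamFn b G K γ κ x` — the **linearised Hamiltonian constraint**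
  `DH(γ,κ) = DS_G(γ) − [2⟨κ,K⟩ − 2 tr(♯γ♯K♯K)] + 2 tr K (tr κ − ⟨γ, K⟩)`, with
  `IsMetricFamilyOn.hasDerivWithinAt_hamAt_linHamFn`: `∂_t H = DH(∂_t G, ∂_t K)` along a smooth
  family of data with symmetric `K` (the variation `∂_t K` is then symmetric);
* `adjHamG G K N`, `adjHamK G K N` — the `N`-rows `DH*_γ N = DS*_G N + 2N K∘K − 2N trK K`,
  `DH*_κ N = −2N K + 2N trK G` of the formal adjoint, and `IsMetricOn.mul_linHamFn_eq`:
  `N · DH(γ,κ) = ⟨γ, DH*_γ N⟩ + ⟨κ, DH*_κ N⟩ + div B_N(γ)`;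
* `IsMetricOn.linConstraint_pairing_eq` — **the Green identity for `DΦ = (DH, DM)`**:
  `N·DH(γ,κ) + DM(γ,κ)(X) = ⟨γ, DH*_γ N + DM*_γ X⟩ + ⟨κ, DH*_κ N + DM*_κ X⟩ + div(B_N + C_X)`
  (Chruściel–Delay 2003, §2: `DΦ*(N, X)` is their `P*(Y, N)` with `Y = −½X^♭`, `J = −2M`);
* `IsMetricOn.linConstraint_pairing_eq_divAt_of_kid` — for a **KID** `(N, X)`
  (`DH*_γ N + DM*_γ X = 0 = DH*_κ N + DM*_κ X`) the pairing `N·DH + DM(X)` is an exact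
  divergence (Moncrief 1975): the source of the finite-dimensional cokernel in the
  Corvino–Schoen / Chruściel–Delay gluing constructions;
* `symAt`, `pairAt_flip_right`, `pairAt_symAt_right` — a symmetric form pairs with `B` and `Bᵀ`
  alike; `lieFormAt β X x` — the coordinate Lie derivative of a field of bilinear forms, with
  `lieFormAt_eq_cov` (`𝓛_X β = ∇_X β + β(∇X·,·) + β(·,∇X·)`), `IsMetricOn.lieFormAt_metric(_eq_symAt)`
  (`𝓛_X G = 2 sym G(∇X·,·)`), `IsMetricOn.apply_covDAt_sharp_contract` (`∇(K(X,·))^♯`);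
* `adjMomKS = −½𝓛_X G + (div X) G`, `adjMomGS = sym K(∇X·,·) + ½∇_X K − ½ div((K(X,·))^♯) G − ½(div X) K`
  — the **symmetrised** rows of `DM*` (`IsMetricOn.pairAt_adjMomK_eq`, `pairAt_adjMomG_eq`), the
  Green identity and KID corollary in symmetrised form (`linConstraint_pairing_eq_sym`,
  `linConstraint_pairing_eq_divAt_of_kid_sym`);
* `IsMetricOn.adjMomS_eq_zero_of_lie_eq_zero` — **Killing fields preserving `K` are KIDs**
  (Moncrief 1975; Beig–Chruściel 1997): `𝓛_X G = 0`, `𝓛_X K = 0` and the momentum constraint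
  `M(X) = 0` at `x` give `DM*ˢ_γ X = 0 = DM*ˢ_κ X` (with `adjHamG_zero`, `adjHamK_zero` for `N = 0`).

## References

* P. T. Chruściel, E. Delay, Mém. SMF 94 (2003), §2. [ChruscielDelay2003]
* V. Moncrief, J. Math. Phys. 16 (1975), 493–498.
* R. Bartnik, J. Isenberg, *The constraint equations*, 2004, §2. [BartnikIsenberg2004]
-/

noncomputable section

set_option maxSynthPendingDepth 3

open Set Filter ContinuousLinearMap Module
open scoped Topology ContDiff

namespace Literature.Geometry.Lorentzian

namespace MetricCoord

variable {E : Type*} [NormedAddCommGroup E] [NormedSpace ℝ E]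

/-! ### The Hamiltonian row and the full adjoint `DΦ*` -/

section FullAdjoint

variable {ι : Type*} [Fintype ι] [FiniteDimensional ℝ E] [CompleteSpace E] (b : Basis ι ℝ E)

section Defs2

variable (G K γ κ : E → E →L[ℝ] E →L[ℝ] ℝ)

/-- The **linearised Hamiltonian constraint** `DH_{(G,K)}(γ, κ)` at `x` as an operator on fields:
`DS_G(γ) − [2⟨κ, K⟩_G − 2 tr(♯γ ♯K ♯K)] + 2 tr_G K (tr_G κ − ⟨γ, K⟩_G)` (the `ρ`-row of
Chruściel–Delay's `P(Q,h)`, 2003, §2; along a family it is `∂_t H`, `hasDerivWithinAt_hamAt_linHamFn`).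
[cite: ChruscielDelay2003, §2] -/
def linHamFn (x : E) : ℝ :=
  linScalAt b G γ x
    - (2 * pairAt G x (κ x) (K x)
      - 2 * traceCLM E ((((sharpAt G x).comp (γ x)).comp ((sharpAt G x).comp (K x))).comp
          ((sharpAt G x).comp (K x))))
    + 2 * mtrAt G x (K x) * (mtrAt G x (κ x) - pairAt G x (γ x) (K x))

/-- The **`γ`-row of `DH*`**: `DH*_γ(N) = DS*_G(N) + 2N K∘K − 2N (tr_G K) K`
(`(K∘K)(v,w) = K(♯K(v,·), w)`; Chruściel–Delay 2003, §2, the `N`-terms of the `h`-row of `P*`).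
[cite: ChruscielDelay2003, §2] -/
def adjHamG (N : E → ℝ) (x : E) : E →L[ℝ] E →L[ℝ] ℝ :=
  adjScalAt G N x + (2 * N x) • (K x).comp ((sharpAt G x).comp (K x))
    - (2 * N x * mtrAt G x (K x)) • K x

/-- The **`κ`-row of `DH*`**: `DH*_κ(N) = −2N K + 2N (tr_G K) G` (Chruściel–Delay 2003, §2,
the `N`-terms of the `Q`-row of `P*`). [cite: ChruscielDelay2003, §2] -/
def adjHamK (N : E → ℝ) (x : E) : E →L[ℝ] E →L[ℝ] ℝ :=
  -(2 * N x) • K x + (2 * N x * mtrAt G x (K x)) • G x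

end Defs2

variable {G : E → E →L[ℝ] E →L[ℝ] ℝ} {V : Set E} {x : E}

omit [CompleteSpace E] in
/-- `tr(♯γ ♯K ♯K) = ⟨γ, K∘K⟩_G`. [folklore] -/
theorem traceCLM_sharp₃_eq_pairAt (γx Kx : E →L[ℝ] E →L[ℝ] ℝ) :
    traceCLM E ((((sharpAt G x).comp γx).comp ((sharpAt G x).comp Kx)).comp ((sharpAt G x).comp Kx)) =
      pairAt G x γx (Kx.comp ((sharpAt G x).comp Kx)) := by
  rw [pairAt_apply]
  congr 1

/-- **The Green identity for the Hamiltonian row**: for smooth symmetric `K, γ, κ` and a smooth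
function `N` on `V`,
`N · DH_{(G,K)}(γ,κ) = ⟨γ, DH*_γ N⟩_G + ⟨κ, DH*_κ N⟩_G + div_G B_N(γ)` with `B = greenVec` of
`CoordScalarCurvatureAdjoint` (only `DS_G` is differential in `γ`). [cite: ChruscielDelay2003, §2] -/
theorem IsMetricOn.mul_linHamFn_eq (hG : IsMetricOn G V) (hx : x ∈ V)
    {K γ κ : E → E →L[ℝ] E →L[ℝ] ℝ}
    (hγ : ContDiffOn ℝ ∞ γ V) (hγs : ∀ y ∈ V, ∀ v w, γ y v w = γ y w v)
    {N : E → ℝ} (hN : ContDiffOn ℝ ∞ N V) :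
    N x * linHamFn b G K γ κ x =
      pairAt G x (γ x) (adjHamG G K N x) + pairAt G x (κ x) (adjHamK G K N x)
        + divAt G (greenVec b G N γ) x := by
  have hi := hG.isInvertible x hx
  have hS := hG.mul_linScalAt_sub_pairAt_adjScalAt b hx hN hγ hγs
  rw [pairAt_comm G x (adjScalAt G N x) (γ x)] at hS
  rw [linHamFn, adjHamG, adjHamK, traceCLM_sharp₃_eq_pairAt]
  simp only [pairAt_add_right, pairAt_sub_right, pairAt_smul_right, pairAt_metric_right hi]
  linear_combination hS

/-- **The Green identity for the full linearised constraint map** `DΦ_{(G,K)} = (DH, DM)` paired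
with a lapse–shift multiplier `(N, X)` (Chruściel–Delay 2003, §2, `P*(Y,N)` with `Y = −½X^♭`,
`J = −2M`; Fischer–Marsden–Moncrief): pointwise on `V`,

  `N · DH(γ,κ) + DM(γ,κ)(X) = ⟨γ, DH*_γ N + DM*_γ X⟩_G + ⟨κ, DH*_κ N + DM*_κ X⟩_G + div_G (B_N + C_X)`.

In particular, when `(N, X)` is a KID of `(G, K)` on `V` (`DH*_γ N + DM*_γ X = 0` and
`DH*_κ N + DM*_κ X = 0`), the left side is an exact divergence — the origin of the cokernel of
`DΦ` in the gluing constructions of Corvino–Schoen and Chruściel–Delay. [cite: ChruscielDelay2003, §2] -/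
theorem IsMetricOn.linConstraint_pairing_eq (hG : IsMetricOn G V) (hx : x ∈ V)
    {K γ κ : E → E →L[ℝ] E →L[ℝ] ℝ} (hK : ContDiffOn ℝ ∞ K V) (hKs : ∀ y ∈ V, ∀ v w, K y v w = K y w v)
    (hγ : ContDiffOn ℝ ∞ γ V) (hγs : ∀ y ∈ V, ∀ v w, γ y v w = γ y w v)
    (hκ : ContDiffOn ℝ ∞ κ V) (hκs : ∀ y ∈ V, ∀ v w, κ y v w = κ y w v)
    {N : E → ℝ} (hN : ContDiffOn ℝ ∞ N V) {X : E → E} (hX : ContDiffOn ℝ ∞ X V) :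
    N x * linHamFn b G K γ κ x + linMomFn b G K γ κ x (X x) =
      pairAt G x (γ x) (adjHamG G K N x + adjMomG G K X x)
        + pairAt G x (κ x) (adjHamK G K N x + adjMomK G X x)
        + (divAt G (greenVec b G N γ) x + divAt G (momGreenVec G K γ κ X) x) := by
  rw [hG.mul_linHamFn_eq b hx hγ hγs hN,
    hG.linMomFn_apply_eq b hx hK hKs hγ hγs hκ hκs hX, pairAt_add_right, pairAt_add_right]
  ring

/-- **KIDs annihilate the linearised constraints up to a divergence**: if `(N, X)` satisfies the
KID equations `DH*_γ N + DM*_γ X = 0`, `DH*_κ N + DM*_κ X = 0` at `x`, then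
`N · DH(γ,κ) + DM(γ,κ)(X) = div_G (B_N + C_X)` at `x` (Moncrief 1975; Chruściel–Delay 2003, §2).
[cite: ChruscielDelay2003, §2] -/
theorem IsMetricOn.linConstraint_pairing_eq_divAt_of_kid (hG : IsMetricOn G V) (hx : x ∈ V)
    {K γ κ : E → E →L[ℝ] E →L[ℝ] ℝ} (hK : ContDiffOn ℝ ∞ K V) (hKs : ∀ y ∈ V, ∀ v w, K y v w = K y w v)
    (hγ : ContDiffOn ℝ ∞ γ V) (hγs : ∀ y ∈ V, ∀ v w, γ y v w = γ y w v)
    (hκ : ContDiffOn ℝ ∞ κ V) (hκs : ∀ y ∈ V, ∀ v w, κ y v w = κ y w v)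
    {N : E → ℝ} (hN : ContDiffOn ℝ ∞ N V) {X : E → E} (hX : ContDiffOn ℝ ∞ X V)
    (hkid₁ : adjHamG G K N x + adjMomG G K X x = 0) (hkid₂ : adjHamK G K N x + adjMomK G X x = 0) :
    N x * linHamFn b G K γ κ x + linMomFn b G K γ κ x (X x) =
      divAt G (greenVec b G N γ) x + divAt G (momGreenVec G K γ κ X) x := by
  rw [hG.linConstraint_pairing_eq b hx hK hKs hγ hγs hκ hκs hN hX, hkid₁, hkid₂]
  simp [pairAt_apply]

namespace IsMetricFamilyOn

variable {G' K' : ℝ → E → E →L[ℝ] E →L[ℝ] ℝ} {S : Set ℝ} {t : ℝ} (hG : IsMetricFamilyOn G' S V)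
  (hK : ContDiffOn ℝ ∞ (fun p : E × ℝ ↦ K' p.2 p.1) (V ×ˢ S))
include hG hK

/-- **`∂_t H = DH_{(G,K)}(∂_t G, ∂_t K)`** along a smooth family of data with symmetric `K`
(the variation `∂_t K` is then symmetric as well). [cite: BartnikIsenberg2004, (2.1)] -/
theorem hasDerivWithinAt_hamAt_linHamFn (hx : x ∈ V) (ht : t ∈ S)
    (hKs : ∀ s ∈ S, ∀ v w, K' s x v w = K' s x w v) :
    HasDerivWithinAt (fun s ↦ hamAt (G' s) (K' s) x)
      (linHamFn b (G' t) (K' t) (tDeriv G' S t) (tDeriv K' S t) x) S t := by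
  have hKt := hasDerivWithinAt_tDeriv_of_contDiffOn hK hx ht
  -- the variation of a symmetric family is symmetric
  have happ : ∀ v w, HasDerivWithinAt (fun s ↦ K' s x v w) (tDeriv K' S t x v w) S t := by
    intro v w
    have a := hKt.clm_apply (hasDerivWithinAt_const t S v)
    simp only [map_zero, add_zero] at a
    have a2 := a.clm_apply (hasDerivWithinAt_const t S w)
    simpa using a2
  have hκs : ∀ v w, tDeriv K' S t x v w = tDeriv K' S t x w v := by
    intro v w
    have heq : (fun s ↦ K' s x v w) =ᶠ[𝓝[S] t] fun s ↦ K' s x w v := by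
      filter_upwards [self_mem_nhdsWithin] with s hs
      exact hKs s hs v w
    have h2' : HasDerivWithinAt (fun s ↦ K' s x v w) (tDeriv K' S t x w v) S t :=
      (happ w v).congr_of_eventuallyEq heq (hKs t ht v w)
    exact (hG.uniqueDiffOn t ht).eq_deriv _ (happ v w) h2'
  have h := ((hG.hasDerivWithinAt_scalAt_linScalAt b hx ht).sub
    (hG.hasDerivWithinAt_normSqAt (K := fun s ↦ K' s x) hx ht hKt (hKs t ht) hκs)).add
    (hG.hasDerivWithinAt_mtrAt_sq (K := fun s ↦ K' s x) hx ht hKt)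
  exact h

end IsMetricFamilyOn

end FullAdjoint

/-! ### Symmetrisation, the coordinate Lie derivative, and KIDs from Killing fields -/

section Symm

variable {ι : Type*} [Fintype ι] [FiniteDimensional ℝ E] [CompleteSpace E] (b : Basis ι ℝ E)

/-- The **symmetric part** `½(B + Bᵀ)` of a bilinear form. [folklore] -/
def symAt (B : E →L[ℝ] E →L[ℝ] ℝ) : E →L[ℝ] E →L[ℝ] ℝ :=
  (2⁻¹ : ℝ) • (B + B.flip)

omit [Fintype ι] [FiniteDimensional ℝ E] [CompleteSpace E] in
/-- Unfolding lemma for `symAt`. [folklore] -/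
@[simp]
theorem symAt_apply (B : E →L[ℝ] E →L[ℝ] ℝ) (v w : E) : symAt B v w = 2⁻¹ * (B v w + B w v) := by
  simp only [symAt, _root_.smul_apply, _root_.add_apply, flip_apply, smul_eq_mul]

variable {G : E → E →L[ℝ] E →L[ℝ] ℝ} {V : Set E} {x : E}

omit [CompleteSpace E] in
/-- **A symmetric form pairs with `B` and with `Bᵀ` alike**: `⟨γ, B⟩_G = ⟨γ, Bᵀ⟩_G` for
symmetric `γ` and `G_x`. [folklore] -/
theorem pairAt_flip_right (hi : (G x).IsInvertible) (hGs : ∀ v w, G x v w = G x w v)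
    {γx : E →L[ℝ] E →L[ℝ] ℝ} (hγs : ∀ v w, γx v w = γx w v) (B : E →L[ℝ] E →L[ℝ] ℝ) :
    pairAt G x γx B.flip = pairAt G x γx B := by
  set b := Module.finBasis ℝ E
  have hgs : ∀ k l, ginv G b x k l = ginv G b x l k := fun k l ↦ ginv_comm b hi hGs k l
  have hexp : ∀ C : E →L[ℝ] E →L[ℝ] ℝ, pairAt G x γx C =
      ∑ k, ∑ l, ∑ m, ∑ n, ginv G b x k l * ginv G b x m n * C (b k) (b n) * γx (b m) (b l) := by
    intro C
    rw [pairAt_eq_sum_ginv b]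
    refine Finset.sum_congr rfl fun k _ ↦ Finset.sum_congr rfl fun l _ ↦ ?_
    rw [sharpAt_eq_sum b (C (b k))]
    simp only [map_sum, map_smul, FunLike.coe_sum, Finset.sum_apply, FunLike.coe_smul, Pi.smul_apply,
      smul_eq_mul, Finset.mul_sum]
    refine Finset.sum_congr rfl fun m _ ↦ ?_
    rw [Finset.sum_mul, Finset.mul_sum]
    refine Finset.sum_congr rfl fun n _ ↦ ?_
    ring
  rw [hexp, hexp]
  simp only [flip_apply]
  -- reverse the order of the four indices: `(k,l,m,n) ↦ (n,m,l,k)`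
  calc ∑ k, ∑ l, ∑ m, ∑ n, ginv G b x k l * ginv G b x m n * B (b n) (b k) * γx (b m) (b l)
      = ∑ k, ∑ l, ∑ n, ∑ m, ginv G b x k l * ginv G b x m n * B (b n) (b k) * γx (b m) (b l) :=
        Finset.sum_congr rfl fun k _ ↦ Finset.sum_congr rfl fun l _ ↦ Finset.sum_comm
    _ = ∑ k, ∑ n, ∑ l, ∑ m, ginv G b x k l * ginv G b x m n * B (b n) (b k) * γx (b m) (b l) :=
        Finset.sum_congr rfl fun k _ ↦ Finset.sum_comm
    _ = ∑ n, ∑ k, ∑ l, ∑ m, ginv G b x k l * ginv G b x m n * B (b n) (b k) * γx (b m) (b l) :=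
        Finset.sum_comm
    _ = ∑ n, ∑ k, ∑ m, ∑ l, ginv G b x k l * ginv G b x m n * B (b n) (b k) * γx (b m) (b l) :=
        Finset.sum_congr rfl fun n _ ↦ Finset.sum_congr rfl fun k _ ↦ Finset.sum_comm
    _ = ∑ n, ∑ m, ∑ k, ∑ l, ginv G b x k l * ginv G b x m n * B (b n) (b k) * γx (b m) (b l) :=
        Finset.sum_congr rfl fun n _ ↦ Finset.sum_comm
    _ = ∑ n, ∑ m, ∑ l, ∑ k, ginv G b x k l * ginv G b x m n * B (b n) (b k) * γx (b m) (b l) :=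
        Finset.sum_congr rfl fun n _ ↦ Finset.sum_congr rfl fun m _ ↦ Finset.sum_comm
    _ = ∑ k, ∑ l, ∑ m, ∑ n, ginv G b x k l * ginv G b x m n * B (b k) (b n) * γx (b m) (b l) := by
        refine Finset.sum_congr rfl fun k _ ↦ Finset.sum_congr rfl fun l _ ↦
          Finset.sum_congr rfl fun m _ ↦ Finset.sum_congr rfl fun n _ ↦ ?_
        rw [hgs n m, hgs l k, hγs (b l) (b m)]
        ring

omit [CompleteSpace E] in
/-- `⟨γ, B⟩_G = ⟨γ, ½(B + Bᵀ)⟩_G` for symmetric `γ`. [folklore] -/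
theorem pairAt_symAt_right (hi : (G x).IsInvertible) (hGs : ∀ v w, G x v w = G x w v)
    {γx : E →L[ℝ] E →L[ℝ] ℝ} (hγs : ∀ v w, γx v w = γx w v) (B : E →L[ℝ] E →L[ℝ] ℝ) :
    pairAt G x γx (symAt B) = pairAt G x γx B := by
  rw [symAt, pairAt_smul_right, pairAt_add_right, pairAt_flip_right hi hGs hγs]
  ring

end Symm

/-! ### The coordinate Lie derivative and the symmetrised adjoint; Killing fields are KIDs -/

section Lie

variable {ι : Type*} [Fintype ι] [FiniteDimensional ℝ E] [CompleteSpace E] (b : Basis ι ℝ E)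

/-- The **coordinate Lie derivative** of a field of bilinear forms `β` along a vector field `X`:
`(𝓛_X β)_x(v, w) = ∂_{X(x)}β(v,w) + β(DX(x)v, w) + β(v, DX(x)w)` (Wald 1984, (C.2.14) in a
chart; for a symmetric `β` and the Levi-Civita `∇` it is `(∇_X β)(v,w) + β(∇_v X, w) + β(v, ∇_w X)`,
`lieFormAt_eq_cov`). [cite: Besse1987, 1.59] -/
def lieFormAt (β : E → E →L[ℝ] E →L[ℝ] ℝ) (X : E → E) (x : E) : E →L[ℝ] E →L[ℝ] ℝ :=
  fderiv ℝ β x (X x) + (β x).comp (fderiv ℝ X x) + ((β x).flip.comp (fderiv ℝ X x)).flip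

omit [Fintype ι] [FiniteDimensional ℝ E] [CompleteSpace E] in
/-- Unfolding lemma for `lieFormAt`. [cite: Besse1987, 1.59] -/
@[simp]
theorem lieFormAt_apply (β : E → E →L[ℝ] E →L[ℝ] ℝ) (X : E → E) (x v w : E) :
    lieFormAt β X x v w = fderiv ℝ β x (X x) v w + β x (fderiv ℝ X x v) w + β x v (fderiv ℝ X x w) := by
  simp [lieFormAt, flip_apply]

omit [Fintype ι] [FiniteDimensional ℝ E] [CompleteSpace E] in
/-- **Covariant form of the Lie derivative**: `𝓛_X β (v,w) = (∇_X β)(v,w) + β(∇_v X, w) + β(v, ∇_w X)`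
(the Christoffel terms cancel; any torsion-free `Γ`). [cite: Besse1987, 1.59] -/
theorem lieFormAt_eq_cov (G β : E → E →L[ℝ] E →L[ℝ] ℝ) (X : E → E) (x v w : E) :
    lieFormAt β X x v w =
      cov₂At G β x (X x) v w + β x (covDAt G X x v) w + β x v (covDAt G X x w) := by
  simp only [lieFormAt_apply, cov₂At_apply, covDAt_apply, map_add, _root_.add_apply]
  ring

variable {G : E → E →L[ℝ] E →L[ℝ] ℝ} {V : Set E} {x : E}

omit [Fintype ι] [FiniteDimensional ℝ E] [CompleteSpace E] in
/-- **`𝓛_X G (v,w) = G(∇_v X, w) + G(v, ∇_w X)`** for the metric itself (`∇G = 0`).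
[cite: Besse1987, 1.59] -/
theorem IsMetricOn.lieFormAt_metric (hG : IsMetricOn G V) (hx : x ∈ V) (X : E → E) (v w : E) :
    lieFormAt G X x v w = G x (covDAt G X x v) w + G x v (covDAt G X x w) := by
  rw [lieFormAt_eq_cov G G X x v w, cov₂At_apply, hG.fderiv_eq_chrAt hx (X x) v w]
  ring

omit [Fintype ι] [FiniteDimensional ℝ E] [CompleteSpace E] in
/-- `𝓛_X G = 2 sym(G(∇X ·, ·))` on `V`. [cite: Besse1987, 1.59] -/
theorem IsMetricOn.lieFormAt_metric_eq_symAt (hG : IsMetricOn G V) (hx : x ∈ V) (X : E → E) :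
    lieFormAt G X x = (2 : ℝ) • symAt ((G x).comp (covDAt G X x)) := by
  ext v w
  rw [hG.lieFormAt_metric hx X v w, _root_.smul_apply, _root_.smul_apply, symAt_apply]
  simp only [ContinuousLinearMap.comp_apply, smul_eq_mul]
  rw [hG.symm x hx v (covDAt G X x w)]
  ring

omit [Fintype ι] [FiniteDimensional ℝ E] in
/-- **`∇(K(X,·))^♯ = ♯[(∇K)(·; X, ·) + K(∇X, ·)]`**: for smooth `K` and `X`,
`G(∇_u (K(X,·))^♯, w) = (∇_u K)(X, w) + K(∇_u X, w)` (Leibniz, `∇♯ = ♯∇`, `∇G = 0`).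
[cite: ONeill1983, Ch. 3, p. 86] -/
theorem IsMetricOn.apply_covDAt_sharp_contract (hG : IsMetricOn G V) (hx : x ∈ V)
    {K : E → E →L[ℝ] E →L[ℝ] ℝ} (hK : DifferentiableAt ℝ K x) {X : E → E} (hX : DifferentiableAt ℝ X x)
    (u w : E) :
    G x (covDAt G (fun y ↦ sharpAt G y (K y (X y))) x u) w =
      cov₂At G K x u (X x) w + K x (covDAt G X x u) w := by
  have hi := hG.isInvertible x hx
  have hθ : HasFDerivAt (fun y ↦ K y (X y)) ((K x).comp (fderiv ℝ X x) + (fderiv ℝ K x).flip (X x)) x :=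
    hK.hasFDerivAt.clm_apply hX.hasFDerivAt
  have hD : HasFDerivAt (fun y ↦ sharpAt G y (K y (X y)))
      ((sharpAt G x).comp ((K x).comp (fderiv ℝ X x) + (fderiv ℝ K x).flip (X x))
        + (fderiv ℝ (sharpAt G) x).flip (K x (X x))) x :=
    (hG.differentiableAt_sharpAt hx).hasFDerivAt.clm_apply hθ
  rw [covDAt_apply, hD.fderiv]
  simp only [_root_.add_apply, ContinuousLinearMap.comp_apply, flip_apply, map_add,
    apply_sharpAt_apply hi, hG.fderiv_sharpAt hx u, _root_.neg_apply, map_neg]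
  rw [hG.fderiv_eq_chrAt hx u (sharpAt G x (K x (X x))) w, hG.chrAt_comm hx (sharpAt G x (K x (X x))) u,
    apply_sharpAt_apply hi, cov₂At_apply, covDAt_apply, map_add, _root_.add_apply,
    hG.chrAt_comm hx (X x) u]
  ring

variable (G) in
/-- The **symmetrised `κ`-row of `DM*`**: `−½ 𝓛_X G + (div X) G`, written as
`−sym(G(∇X·,·)) + (div X) G` (Chruściel–Delay 2003, §2, `2(∇_{(i}Y_{j)} − ∇^l Y_l g_{ij})`).
[cite: ChruscielDelay2003, §2] -/
def adjMomKS (X : E → E) (x : E) : E →L[ℝ] E →L[ℝ] ℝ :=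
  -symAt ((G x).comp (covDAt G X x)) + (divAt G X x) • G x

variable (G) in
/-- The **symmetrised `γ`-row of `DM*`** at data `(G, K)`:
`sym(K(∇X·,·)) + ½ ∇_X K − ½ div((K(X,·))^♯) G − ½ (div X) K = ½ 𝓛_X K − ½ div((K(X,·))^♯) G − ½ (div X) K`
(Chruściel–Delay 2003, §2, the `Y`-terms of the `h`-row of `P*`). [cite: ChruscielDelay2003, §2] -/
def adjMomGS (K : E → E →L[ℝ] E →L[ℝ] ℝ) (X : E → E) (x : E) : E →L[ℝ] E →L[ℝ] ℝ :=
  symAt ((K x).comp (covDAt G X x)) + (2⁻¹ : ℝ) • cov₂At G K x (X x)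
    - (2⁻¹ * divAt G (fun y ↦ sharpAt G y (K y (X y))) x) • G x
    - (2⁻¹ * divAt G X x) • K x

omit [CompleteSpace E] in
/-- `⟨κ, DM*_κ X⟩ = ⟨κ, adjMomKS⟩` for symmetric `κ`. [cite: ChruscielDelay2003, §2] -/
theorem IsMetricOn.pairAt_adjMomK_eq (hG : IsMetricOn G V) (hx : x ∈ V)
    {κx : E →L[ℝ] E →L[ℝ] ℝ} (hκs : ∀ v w, κx v w = κx w v) (X : E → E) :
    pairAt G x κx (adjMomK G X x) = pairAt G x κx (adjMomKS G X x) := by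
  have hi := hG.isInvertible x hx
  rw [adjMomK, adjMomKS, pairAt_add_right, pairAt_add_right, pairAt_neg_right, pairAt_neg_right,
    pairAt_symAt_right hi (hG.symm x hx) hκs]

/-- `⟨γ, DM*_γ X⟩ = ⟨γ, adjMomGS⟩` for symmetric `γ`, `K` (and `∇K` symmetric in its last slots).
[cite: ChruscielDelay2003, §2] -/
theorem IsMetricOn.pairAt_adjMomG_eq (hG : IsMetricOn G V) (hx : x ∈ V)
    {γx : E →L[ℝ] E →L[ℝ] ℝ} (hγs : ∀ v w, γx v w = γx w v)
    {K : E → E →L[ℝ] E →L[ℝ] ℝ} (hK : ContDiffOn ℝ ∞ K V) (hKs : ∀ y ∈ V, ∀ v w, K y v w = K y w v)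
    {X : E → E} (hX : DifferentiableAt ℝ X x) :
    pairAt G x γx (adjMomG G K X x) = pairAt G x γx (adjMomGS G K X x) := by
  have hi := hG.isInvertible x hx
  have hKd : DifferentiableAt ℝ K x := ((hK x hx).contDiffAt (hG.mem_nhds hx)).differentiableAt (by simp)
  have hcs : ∀ W Y Z, cov₂At G K x W Y Z = cov₂At G K x W Z Y := by
    have hsev : ∀ᶠ y in 𝓝 x, ∀ v w, K y v w = K y w v := (hG.eventually_mem hx).mono fun y hy ↦ hKs y hy
    exact cov₂At_symm hKd hsev
  -- `−C + G(∇Y·,·) = K(∇X·,·)`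
  have hkey : -(flipCLM.comp (cov₂At G K x)).flip (X x)
      + (G x).comp (covDAt G (fun y ↦ sharpAt G y (K y (X y))) x) = (K x).comp (covDAt G X x) := by
    ext u w
    simp only [_root_.add_apply, _root_.neg_apply, flip_apply, ContinuousLinearMap.comp_apply,
      flipCLM_apply, hG.apply_covDAt_sharp_contract hx hKd hX u w, hcs u w (X x)]
    ring
  rw [adjMomG, adjMomGS, hkey]
  simp only [pairAt_add_right, pairAt_sub_right, pairAt_symAt_right hi (hG.symm x hx) hγs]
  ring

end Lie

/-! ### Killing fields preserving `K` are KIDs -/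

section Killing

variable {ι : Type*} [Fintype ι] [FiniteDimensional ℝ E] [CompleteSpace E] (b : Basis ι ℝ E)
  {G : E → E →L[ℝ] E →L[ℝ] ℝ} {V : Set E} {x : E}

omit [CompleteSpace E] in
/-- `tr_G Bᵀ = tr_G B` (symmetric `G_x`). [folklore] -/
theorem mtrAt_flip (hi : (G x).IsInvertible) (hGs : ∀ v w, G x v w = G x w v) (B : E →L[ℝ] E →L[ℝ] ℝ) :
    mtrAt G x B.flip = mtrAt G x B := by
  set b := Module.finBasis ℝ E
  rw [mtrAt_eq_sum b, mtrAt_eq_sum b, Finset.sum_comm]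
  refine Finset.sum_congr rfl fun k _ ↦ Finset.sum_congr rfl fun l _ ↦ ?_
  rw [flip_apply, ginv_comm b hi hGs l k]

omit [CompleteSpace E] in
/-- `tr_G (G ∘ A) = tr A`. [folklore] -/
theorem mtrAt_metric_comp (hi : (G x).IsInvertible) (A : E →L[ℝ] E) :
    mtrAt G x ((G x).comp A) = traceCLM E A := by
  rw [mtrAt_eq_traceCLM]
  congr 1
  ext v
  simp only [ContinuousLinearMap.comp_apply, sharpAt_apply hi]

omit [CompleteSpace E] in
/-- `tr_G (K ∘ A) = ⟨K, G ∘ A⟩_G`. [folklore] -/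
theorem mtrAt_comp_eq_pairAt (hi : (G x).IsInvertible) (Kx : E →L[ℝ] E →L[ℝ] ℝ) (A : E →L[ℝ] E) :
    mtrAt G x (Kx.comp A) = pairAt G x Kx ((G x).comp A) := by
  rw [mtrAt_eq_traceCLM, pairAt_apply]
  congr 1
  ext v
  simp only [ContinuousLinearMap.comp_apply, sharpAt_apply hi]

omit [CompleteSpace E] in
/-- `div X = tr_G (G(∇X ·, ·))`. [folklore] -/
theorem divAt_eq_mtrAt (hi : (G x).IsInvertible) (X : E → E) :
    divAt G X x = mtrAt G x ((G x).comp (covDAt G X x)) := by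
  rw [divAt_eq, mtrAt_metric_comp hi]

omit [Fintype ι] [CompleteSpace E] in
/-- `DH*(0) = 0`: the `N`-rows vanish for `N = 0`. [cite: ChruscielDelay2003, §2] -/
theorem adjHamG_zero (K : E → E →L[ℝ] E →L[ℝ] ℝ) : adjHamG G K (fun _ ↦ (0 : ℝ)) x = 0 := by
  have h1 : hessAt G (fun _ : E ↦ (0 : ℝ)) x = 0 := by
    ext v w
    simp [hessAt_apply]
  have h2 : lapAt G (fun _ : E ↦ (0 : ℝ)) x = 0 := by
    rw [lapAt, h1, mtrAt_eq_traceCLM, ContinuousLinearMap.comp_zero, map_zero]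
  rw [adjHamG, adjScalAt, h1, h2]
  simp

omit [Fintype ι] [FiniteDimensional ℝ E] [CompleteSpace E] in
/-- `DH*_κ(0) = 0`. [cite: ChruscielDelay2003, §2] -/
theorem adjHamK_zero (K : E → E →L[ℝ] E →L[ℝ] ℝ) : adjHamK G K (fun _ ↦ (0 : ℝ)) x = 0 := by
  rw [adjHamK]; simp

/-- **The Green identity for `DΦ` with the symmetrised adjoint**:
`N·DH(γ,κ) + DM(γ,κ)(X) = ⟨γ, DH*_γ N + DM*ˢ_γ X⟩ + ⟨κ, DH*_κ N + DM*ˢ_κ X⟩ + div(B_N + C_X)`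
(`adjMomGS`, `adjMomKS`; Chruściel–Delay 2003, §2, `P*(Y,N)`). [cite: ChruscielDelay2003, §2] -/
theorem IsMetricOn.linConstraint_pairing_eq_sym (hG : IsMetricOn G V) (hx : x ∈ V)
    {K γ κ : E → E →L[ℝ] E →L[ℝ] ℝ} (hK : ContDiffOn ℝ ∞ K V) (hKs : ∀ y ∈ V, ∀ v w, K y v w = K y w v)
    (hγ : ContDiffOn ℝ ∞ γ V) (hγs : ∀ y ∈ V, ∀ v w, γ y v w = γ y w v)
    (hκ : ContDiffOn ℝ ∞ κ V) (hκs : ∀ y ∈ V, ∀ v w, κ y v w = κ y w v)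
    {N : E → ℝ} (hN : ContDiffOn ℝ ∞ N V) {X : E → E} (hX : ContDiffOn ℝ ∞ X V) :
    N x * linHamFn b G K γ κ x + linMomFn b G K γ κ x (X x) =
      pairAt G x (γ x) (adjHamG G K N x + adjMomGS G K X x)
        + pairAt G x (κ x) (adjHamK G K N x + adjMomKS G X x)
        + (divAt G (greenVec b G N γ) x + divAt G (momGreenVec G K γ κ X) x) := by
  have hXd : DifferentiableAt ℝ X x := ((hX x hx).contDiffAt (hG.mem_nhds hx)).differentiableAt (by simp)
  rw [hG.linConstraint_pairing_eq b hx hK hKs hγ hγs hκ hκs hN hX, pairAt_add_right, pairAt_add_right,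
    pairAt_add_right, pairAt_add_right, hG.pairAt_adjMomG_eq hx (hγs x hx) hK hKs hXd,
    hG.pairAt_adjMomK_eq hx (hκs x hx)]

/-- **KIDs annihilate `DΦ` up to a divergence** (symmetrised KID equations
`DH*_γ N + DM*ˢ_γ X = 0`, `DH*_κ N + DM*ˢ_κ X = 0`; Moncrief 1975). [cite: ChruscielDelay2003, §2] -/
theorem IsMetricOn.linConstraint_pairing_eq_divAt_of_kid_sym (hG : IsMetricOn G V) (hx : x ∈ V)
    {K γ κ : E → E →L[ℝ] E →L[ℝ] ℝ} (hK : ContDiffOn ℝ ∞ K V) (hKs : ∀ y ∈ V, ∀ v w, K y v w = K y w v)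
    (hγ : ContDiffOn ℝ ∞ γ V) (hγs : ∀ y ∈ V, ∀ v w, γ y v w = γ y w v)
    (hκ : ContDiffOn ℝ ∞ κ V) (hκs : ∀ y ∈ V, ∀ v w, κ y v w = κ y w v)
    {N : E → ℝ} (hN : ContDiffOn ℝ ∞ N V) {X : E → E} (hX : ContDiffOn ℝ ∞ X V)
    (hkid₁ : adjHamG G K N x + adjMomGS G K X x = 0) (hkid₂ : adjHamK G K N x + adjMomKS G X x = 0) :
    N x * linHamFn b G K γ κ x + linMomFn b G K γ κ x (X x) =
      divAt G (greenVec b G N γ) x + divAt G (momGreenVec G K γ κ X) x := by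
  rw [hG.linConstraint_pairing_eq_sym b hx hK hKs hγ hγs hκ hκs hN hX, hkid₁, hkid₂]
  simp [pairAt_apply]

/-- **Killing fields preserving `K` are KIDs** (Moncrief 1975; Beig–Chruściel 1997, §2):
if `𝓛_X G = 0` on `V` (a Killing field of `G`), `𝓛_X K = 0` at `x`, and the momentum
constraint `M(X) = (div_G K)(X) − ∂_X tr_G K` vanishes at `x`, then `(N, X) = (0, X)` satisfies
the (symmetrised) KID equations at `x`: `DM*ˢ_γ X = 0` and `DM*ˢ_κ X = 0` (the `N`-rows vanish,
`adjHamG_zero`, `adjHamK_zero`). [cite: ChruscielDelay2003, §2] -/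
theorem IsMetricOn.adjMomS_eq_zero_of_lie_eq_zero (hG : IsMetricOn G V) (hx : x ∈ V)
    {K : E → E →L[ℝ] E →L[ℝ] ℝ} (hK : ContDiffOn ℝ ∞ K V) (hKs : ∀ y ∈ V, ∀ v w, K y v w = K y w v)
    {X : E → E} (hX : ContDiffOn ℝ ∞ X V)
    (hLG : lieFormAt G X x = 0) (hLK : lieFormAt K X x = 0) (hM : momFn b G K x (X x) = 0) :
    adjMomGS G K X x = 0 ∧ adjMomKS G X x = 0 := by
  have hi := hG.isInvertible x hx
  have hGs := hG.symm x hx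
  have hXd : DifferentiableAt ℝ X x := ((hX x hx).contDiffAt (hG.mem_nhds hx)).differentiableAt (by simp)
  have hKd : DifferentiableAt ℝ K x := ((hK x hx).contDiffAt (hG.mem_nhds hx)).differentiableAt (by simp)
  -- `sym(G(∇X·,·)) = 0` and `div X = 0`
  have hsym : symAt ((G x).comp (covDAt G X x)) = 0 := by
    have h := hG.lieFormAt_metric_eq_symAt hx X
    rw [hLG] at h
    exact (smul_eq_zero.mp h.symm).resolve_left two_ne_zero
  have hdivX : divAt G X x = 0 := by
    have h1 : mtrAt G x (symAt ((G x).comp (covDAt G X x))) = mtrAt G x ((G x).comp (covDAt G X x)) := by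
      rw [symAt, mtrAt_smul, mtrAt_add, mtrAt_flip hi hGs]
      ring
    rw [divAt_eq_mtrAt hi, ← h1, hsym, mtrAt_eq_traceCLM, ContinuousLinearMap.comp_zero, map_zero]
  have hKS : adjMomKS G X x = 0 := by
    rw [adjMomKS, hsym, hdivX]; simp
  -- `⟨K, G(∇X·,·)⟩ = 0`
  have hpair : pairAt G x (K x) ((G x).comp (covDAt G X x)) = 0 := by
    rw [← pairAt_symAt_right hi hGs (hKs x hx), hsym, pairAt_apply, ContinuousLinearMap.comp_zero,
      ContinuousLinearMap.comp_zero, map_zero]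
  -- `sym(K(∇X·,·)) + ½ ∇_X K = ½ 𝓛_X K = 0`
  have hsymK : symAt ((K x).comp (covDAt G X x)) + (2⁻¹ : ℝ) • cov₂At G K x (X x) = 0 := by
    ext v w
    have h := congrArg (fun B : E →L[ℝ] E →L[ℝ] ℝ ↦ B v w) hLK
    simp only [zero_apply] at h
    rw [lieFormAt_eq_cov G K X x v w] at h
    simp only [_root_.add_apply, _root_.smul_apply, symAt_apply, ContinuousLinearMap.comp_apply,
      smul_eq_mul, zero_apply]
    rw [hKs x hx (covDAt G X x w) v]
    linear_combination (2⁻¹ : ℝ) * h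
  -- `∂_X tr_G K = 0`
  have hdtr : fderiv ℝ (fun y ↦ mtrAt G y (K y)) x (X x) = 0 := by
    have hcov : cov₂At G K x (X x) = -((K x).comp (covDAt G X x)) - ((K x).flip.comp (covDAt G X x)).flip := by
      ext v w
      have h := congrArg (fun B : E →L[ℝ] E →L[ℝ] ℝ ↦ B v w) hLK
      simp only [zero_apply] at h
      rw [lieFormAt_eq_cov G K X x v w] at h
      simp only [_root_.sub_apply, _root_.neg_apply, flip_apply, ContinuousLinearMap.comp_apply]
      linarith
    have hKfl : (K x).flip = K x := by ext v w; exact hKs x hx w v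
    rw [hG.fderiv_mtrAt hx hKd (X x), hcov, mtrAt_sub, mtrAt_neg, mtrAt_flip hi hGs, hKfl,
      mtrAt_comp_eq_pairAt hi, hpair]
    simp
  -- `div (K(X,·))^♯ = M(X) + ∂_X tr K + ⟨K, G(∇X·,·)⟩ = 0`
  have hdivY : divAt G (fun y ↦ sharpAt G y (K y (X y))) x = 0 := by
    have hsum : ∑ k, ∑ l, ginv G b x k l * cov₂At G K x (b k) (b l) (X x) =
        momFn b G K x (X x) + fderiv ℝ (fun y ↦ mtrAt G y (K y)) x (X x) := by
      rw [momFn_eq]; ring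
    rw [hG.divAt_sharpAt_contractVec b hx hK hKs hXd, hpair, add_zero, hsum, hM, hdtr, add_zero]
  refine ⟨?_, hKS⟩
  rw [adjMomGS, hsymK, hdivY, hdivX]
  simp

end Killing

end MetricCoord

end Literature.Geometry.Lorentzian

end
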